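import Literature.AnabelianGeometry.EtaleTheta.Discharge.Sec5Thm57FinalKnitV4
import Literature.AnabelianGeometry.EtaleTheta.Discharge.Sec5Thm57FinalKnitV3OfThetaSettingNonDilating

/-!
# [EtTh] §5, Theorem 5.7 — FINAL KNIT v4 AT THE TOWER OF THE SETTING with the (A)-block EMPTY (canonical monoid vocabularies: `hnd` ⟸ the §4
# package): `hsurj` AND `hivPiso` ⟸ the ONE roots-of-constants law `hL` over `A_1`, `hP24` ⟸ the frozen FACT Cor. 2.18 (i) (F-0620), `hYdd` a
# theorem (pp. 285–286, 313, 315–316, 319, 323, 329–331 / PDF pp. 59–60, 87, 89–90, 93, 97, 103–105)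

Mochizuki, *The étale theta function and its Frobenioid-theoretic manifestations*, Publ. RIMS **45** (2009)
[cite: MochizukiEtTh2009, Thm 5.7 p.329–330 (PDF pp.103–104); Prop 4.2 (iv) p.315–316 (PDF pp.89–90); Lem 5.8 p.331 (PDF p.105); Prop 5.1
p.323 (PDF p.97); Thm 4.4 p.319 (PDF p.93); Def 4.1 (iii) p.313 (PDF p.87); Cor 2.18 (i) p.285–286 (PDF pp.59–60); §5 p.322 (PDF p.96)].
abc-iut cell, layer L2, node `EtTh:Thm5.7`; seat abc-iut-w5-d123 (gen 7), row «'_final_v4' SETTING TWINS» (abc-iut-L2-lead (gen 5) R659/R670) —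
companion of `Sec5Thm57FinalKnitV4OfThetaSetting.lean` (this seat: abstract vocabulary `V`, `hnd` kept) by the device of this seat's
`Sec5Thm57FinalKnitV3OfThetaSettingNonDilating.lean` (p462366) / `…OfConstantRootsLawOfThetaSettingNonDilating.lean` (p467722).  PROOF-ONLY
(0 definitions, 0 new named facts; nothing landed is edited or restated).

THE POINT.  At the tower OF THE SETTING `(X, 𝒯, ιX) := (Π^tp_X̲̲, Cu.thetaEnvTower τ hC hS, id)` (abc-iut-L2-t4's `ofThetaSettingFamily`, `rfl`)
abc-iut-f-123's `thetaRootPreservedAll_ofConnectedTemperoidYddFamily_final_v4` (abc-iut-w6-d077's '_final_v3' p458453 with `hsurj` AND `hivPiso`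
discharged from the ONE roots-of-constants law `hL` over `A_1 := (R 1).AN` via p462665 and the R480 port p469135) loses THREE more displayed
binders once the realified divisor data are typed over a CANONICAL monoid vocabulary: (A) `hnd` («`Φ` non-dilating», [EtTh] Prop. 5.1 p.323 =
Thm. 4.4's standing hypothesis p.319) is the §4 package's own field (`hnd_of_thm44Hyp_treeMonoidVocabWeak` / `…_treeMonoidVocab`, this seat
p448710); the anchor binder `hP24` is the `Π^tp_Ÿ`-clause of the frozen FACT `RigidData.Cor218_i` (F-0620) at abc-iut-L2-t8's
`Cu.rigidData μ' hC hS h15iii L` (`Cu.hP24_thetaEnvTower_of_cor218_i`, this seat p452318); `hYdd` is abc-iut-L2-t4's `hYdd_ofThetaSetting` read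
for the tower (`hYdd_thetaEnvTower_ofThetaSetting`, p448710).
RESULTS `thetaRootPreservedAll_ofThetaSettingYddFamily_final_v4_treeMonoidVocabWeak_of_cor218_i` / `…_treeMonoidVocab_of_cor218_i`: Thm. 5.7
(root level, all identifications) at every level of the tower of the Setting MODULO exactly: the junction data of record {`hc₀`, `ht`;
`ConstantsDictionary` `hD₁`, `hY₁`; `cnst`, `G`, `ecn`, `hP34`}; `hF`, `hαover`; (anchor) `hcharAN` («`A_N^bs` characteristic», abc-iut-w6-d077's
residual), `hdivA` (⟸ abc-iut-L2-d4's p457957 by term); (§4) `h44`, `ψ`, `hpull`, `hii`, `h3`, `h4b`, `h8`, `h15a`, `h15`, `D N`; the ONE law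
`hL` over `A_1` (G-w4d044-1's shape); (per normalised anchor) `hcfix`; (C) `hc`; and the FACT inputs `h218i` (F-0620), `h15iii` (`Prop15iii`,
F-0591), cusp labels `L` BY NAME — NO (A)-binder, NO `hP24`, NO `hYdd`, NO `hsurj`, NO `hivPiso`.
HONEST FRAMING: kernel-checked composition of landed theorems for data so parametrised (no instance of the class `TemperedFrobenioid T₀
(ConnectedPart (BTemp Π^tp_X̲̲)) VD` for an actual curve is constructed anywhere in the tree); the law `hL` is NOT discharged here; F-0620 /
`Prop15iii` are FACT-policy assumption labels (nothing of [EtTh] is asserted unconditionally); typed ≠ discharged — PROVED modulo the displayed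
binders; no side taken on anything downstream ([IUTchIII] Cor. 3.12 in particular).
-/

noncomputable section

namespace Literature.AnabelianGeometry.EtaleTheta

open CategoryTheory Opposite Literature.AlgebraicGeometry.Frobenioids Literature.AnabelianGeometry.SemiGraphs
  Literature.AnabelianGeometry.SemiGraphs.GaloisObjects

universe v₀ u₁ v₁

namespace ThetaFrobenioidTower

section Weak

variable {p : ℕ} [Fact p.Prime] {DS : ThetaSetting p} {ES : DS.EtaleThetaData} {l' : ℕ} (Cu : ES.DoubleUnderline l')
  {e' : DS.toTemperedCurve.GroupLevelData} {Es : Set ℕ+} (τ : DS.CyclotomeTower l' Es) (hC : DS.Compat) (hS : DS.Sec2Hyps)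
  {D₀ : Type} [Category.{v₀} D₀] {T₀ : RealifiedDivisorMonoids (D₀ := D₀) treeMonoidVocabWeak.{0}}
  {VD : FrdICatStub.{1, 0, 0} (ConnectedPart (BTemp (Cu.temperedArithmeticGroup e').Pi))}
  {tf : TemperedFrobenioid T₀ (ConnectedPart (BTemp (Cu.temperedArithmeticGroup e').Pi)) VD} {hZ : tf.monoidType = MonoidType.Z}
  {hP : ∀ A : (ConnectedPart (BTemp (Cu.temperedArithmeticGroup e').Pi))ᵒᵖ, IsPerfect (tf.Φ.carrier A)}
  {NH : Subgroup (Field.absoluteGaloisGroup DS.K) → tf.category → ℕ+ → Prop}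
  {pullFrac : ∀ {A A' : (BiKummerSetting.mkOfConnectedTemperoidYddTower (Cu.temperedArithmeticGroup e') tf hZ hP NH (Cu.thetaEnvTower τ hC hS)
    (ContinuousMulEquiv.refl _)).C} (_ : A' ⟶ A), (BiKummerSetting.mkOfConnectedTemperoidYddTower (Cu.temperedArithmeticGroup e') tf hZ hP NH
    (Cu.thetaEnvTower τ hC hS) (ContinuousMulEquiv.refl _)).biratUnits A → (BiKummerSetting.mkOfConnectedTemperoidYddTower
    (Cu.temperedArithmeticGroup e') tf hZ hP NH (Cu.thetaEnvTower τ hC hS) (ContinuousMulEquiv.refl _)).biratUnits A'}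
  {θ : (BiKummerSetting.mkOfConnectedTemperoidYddTower (Cu.temperedArithmeticGroup e') tf hZ hP NH (Cu.thetaEnvTower τ hC hS)
    (ContinuousMulEquiv.refl _)).biratUnits (BiKummerSetting.mkOfConnectedTemperoidYddTower (Cu.temperedArithmeticGroup e') tf hZ hP NH
    (Cu.thetaEnvTower τ hC hS) (ContinuousMulEquiv.refl _)).Aodot}
  {Bl : (BiKummerSetting.mkOfConnectedTemperoidYddTower (Cu.temperedArithmeticGroup e') tf hZ hP NH (Cu.thetaEnvTower τ hC hS)
    (ContinuousMulEquiv.refl _)).C}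
  {Pl : (BiKummerSetting.mkOfConnectedTemperoidYddTower (Cu.temperedArithmeticGroup e') tf hZ hP NH (Cu.thetaEnvTower τ hC hS)
    (ContinuousMulEquiv.refl _)).FractionPair θ Bl}
  {Rl : (BiKummerSetting.mkOfConnectedTemperoidYddTower (Cu.temperedArithmeticGroup e') tf hZ hP NH (Cu.thetaEnvTower τ hC hS)
    (ContinuousMulEquiv.refl _)).NthRoot θ Pl Cu.lPNat pullFrac}
  (h : ModelFrobenioid.Hypotheses tf.divisorMonoid tf.ratFnFunctor)
  (Q : FrobenioidTheta.ThetaSubquotientStub.{0} (ConnectedPart (BTemp (Cu.temperedArithmeticGroup e').Pi)))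
  (R : ∀ N : ℕ+, (BiKummerSetting.mkOfConnectedTemperoidYddTower (Cu.temperedArithmeticGroup e') tf hZ hP NH (Cu.thetaEnvTower τ hC hS)
    (ContinuousMulEquiv.refl _)).NthRoot Rl.root Rl.pair N pullFrac)
  (K' : Type) [Field K'] {X₀ : ConnectedPart (BTemp (Cu.temperedArithmeticGroup e').Pi)}
  (hX₀ : ∀ Y : ConnectedPart (BTemp (Cu.temperedArithmeticGroup e').Pi), Subsingleton (Y ⟶ X₀))
  (t : ∀ N : ℕ+, (R N).BN.base ⟶ X₀) (c₀ : K'ˣ →* (tf.ratFnFunctor.obj (op X₀))ˣ)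
  (hc₀ : Function.Injective c₀) (ht : ∀ N : ℕ+, Function.Injective (tf.ratFnFunctor.map (t N).op).hom)
  (hinvc : ∀ (N : ℕ+) (g : Aut (R N).AN.base), pull tf.divisorMonoid g.hom (ModelFrobenioid.div (R N).pair.num) = ModelFrobenioid.div (R
    N).pair.num)
  (hinvp : ∀ (N : ℕ+) (y : (Cu.thetaEnvTower τ hC hS).PiX), y ∈ (Cu.thetaEnvTower τ hC hS).PiYdd → pull tf.divisorMonoid
    ((BiKummerSetting.mkOfConnectedTemperoidYddTower (Cu.temperedArithmeticGroup e') tf hZ hP NH (Cu.thetaEnvTower τ hC hS) (ContinuousMulEquiv.refl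
    _)).galoisSurj (R N).AN.base (R N).αData.isGalois ((ContinuousMulEquiv.refl _) y)).hom (ModelFrobenioid.div (R N).pair.den) =
    ModelFrobenioid.div (R N).pair.den)
  (α : ∀ {N N' : ℕ+}, (N : ℕ) ∣ N' → ((R N').AN ⟶ (R N).AN))
  (β : ∀ {N N' : ℕ+}, (N : ℕ) ∣ N' → ((R N').BN ⟶ (R N).BN))
  (comm_sCap : ∀ {N N' : ℕ+} (hd : (N : ℕ) ∣ N'), (R N').pair.num ≫ β hd = α hd ≫ (R N).pair.num)
  (comm_sCup : ∀ {N N' : ℕ+} (hd : (N : ℕ) ∣ N'), (R N').pair.den ≫ β hd = α hd ≫ (R N).pair.den)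
  (isIsometry_α : ∀ {N N' : ℕ+} (hd : (N : ℕ) ∣ N'), ((BiKummerSetting.mkOfConnectedTemperoidYddTower (Cu.temperedArithmeticGroup e') tf hZ hP NH
    (Cu.thetaEnvTower τ hC hS) (ContinuousMulEquiv.refl _)).sec5Stub h).pre.IsIsometry (α hd))
  (degFr_α : ∀ {N N' : ℕ+} (hd : (N : ℕ) ∣ N'), (((BiKummerSetting.mkOfConnectedTemperoidYddTower (Cu.temperedArithmeticGroup e') tf hZ hP NH
    (Cu.thetaEnvTower τ hC hS) (ContinuousMulEquiv.refl _)).sec5Stub h).pre.degFr (α hd) : ℕ) * N = N')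
  (isIsometry_β : ∀ {N N' : ℕ+} (hd : (N : ℕ) ∣ N'), ((BiKummerSetting.mkOfConnectedTemperoidYddTower (Cu.temperedArithmeticGroup e') tf hZ hP NH
    (Cu.thetaEnvTower τ hC hS) (ContinuousMulEquiv.refl _)).sec5Stub h).pre.IsIsometry (β hd))
  (degFr_β : ∀ {N N' : ℕ+} (hd : (N : ℕ) ∣ N'), (((BiKummerSetting.mkOfConnectedTemperoidYddTower (Cu.temperedArithmeticGroup e') tf hZ hP NH
    (Cu.thetaEnvTower τ hC hS) (ContinuousMulEquiv.refl _)).sec5Stub h).pre.degFr (β hd) : ℕ) * N = N')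
  (baseFrob_α : ∀ {N N' : ℕ+} (hd : (N : ℕ) ∣ N'), (BiKummerSetting.mkOfConnectedTemperoidYddTower (Cu.temperedArithmeticGroup e') tf hZ hP NH
    (Cu.thetaEnvTower τ hC hS) (ContinuousMulEquiv.refl _)).IsOfBaseFrobeniusType (α hd))
  (h44 : BiKummerSetting.Thm44Hyp (BiKummerSetting.mkOfConnectedTemperoidYddTower (Cu.temperedArithmeticGroup e') tf hZ hP NH (Cu.thetaEnvTower τ hC
    hS) (ContinuousMulEquiv.refl _)) (BiKummerSetting.mkOfConnectedTemperoidYddTower (Cu.temperedArithmeticGroup e') tf hZ hP NH (Cu.thetaEnvTower τ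
    hC hS) (ContinuousMulEquiv.refl _)))
  (ψ : ∀ A : (BiKummerSetting.mkOfConnectedTemperoidYddTower (Cu.temperedArithmeticGroup e') tf hZ hP NH (Cu.thetaEnvTower τ hC hS)
    (ContinuousMulEquiv.refl _)).C, (BiKummerSetting.mkOfConnectedTemperoidYddTower (Cu.temperedArithmeticGroup e') tf hZ hP NH (Cu.thetaEnvTower τ
    hC hS) (ContinuousMulEquiv.refl _)).biratUnits A ≃* (BiKummerSetting.mkOfConnectedTemperoidYddTower (Cu.temperedArithmeticGroup e') tf hZ hP NH
    (Cu.thetaEnvTower τ hC hS) (ContinuousMulEquiv.refl _)).biratUnits (h44.Ψ.functor.obj A))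
  (hpull : ∀ {A A' : (BiKummerSetting.mkOfConnectedTemperoidYddTower (Cu.temperedArithmeticGroup e') tf hZ hP NH (Cu.thetaEnvTower τ hC hS)
    (ContinuousMulEquiv.refl _)).C} (φ : A' ⟶ A) (f : (BiKummerSetting.mkOfConnectedTemperoidYddTower (Cu.temperedArithmeticGroup e') tf hZ hP NH
    (Cu.thetaEnvTower τ hC hS) (ContinuousMulEquiv.refl _)).biratUnits A), ψ A' (pullFrac φ f) = pullFrac (h44.Ψ.functor.map φ) (ψ A f))
  (hii : BiKummerSetting.Thm44_ii h44 ψ) (h3 : h44.PreservesFrobeniusStructure) (h4b : h44.PreservesBaseFrobeniusTypeData)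
  (h8 : h44.PreservesAmple) (h15a : h44.PreservesFixedByHA ψ) (h15 : h44.PreservesSaturated ψ)
  (D : ∀ N : ℕ+, (BiKummerSetting.mkOfConnectedTemperoidYddTower (Cu.temperedArithmeticGroup e') tf hZ hP NH (Cu.thetaEnvTower τ hC hS)
    (ContinuousMulEquiv.refl _)).BaseFrobeniusTypeData (α (one_dvd_level N)))

include hX₀ h hc₀ ht comm_sCap comm_sCup isIsometry_α degFr_α isIsometry_β degFr_β hpull hii h3 h4b h8 h15a h15 in
/-- **[EtTh] Theorem 5.7 — FINAL KNIT v4 at the tower OF THE SETTING, (A)-block EMPTY, weak canonical monoid vocabulary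
`treeMonoidVocabWeak`** (abc-iut-L2-d2: the reading at tempered coverings with infinitely many special-fibre components — `Ÿ`, `Z_∞`):
abc-iut-f-123's `…_final_v4` at `(Π^tp_X̲̲, Cu.thetaEnvTower τ hC hS, id)` with `hnd := hnd_of_thm44Hyp_treeMonoidVocabWeak h44` (Prop. 5.1's
«non-dilating» = the §4 package's own field, p448710), `hP24 := Cu.hP24_thetaEnvTower_of_cor218_i … h218i` (F-0620) and
`hYdd := hYdd_thetaEnvTower_ofThetaSetting …`.  RESIDUAL: junction data of record {`hc₀`, `ht`; `hD₁`, `hY₁`; `cnst`, `G`, `ecn`, `hP34`}; `hF`,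
`hαover`; `hcharAN`, `hdivA`; the §4 package; the ONE law `hL`; `hcfix`; (C) `hc`; FACT inputs `h218i` (F-0620), `h15iii` (F-0591), `L` — NO
(A)-binder, NO `hP24`, NO `hsurj`, NO `hivPiso`.
[cite: MochizukiEtTh2009, Thm 5.7 p.329–330 (PDF pp.103–104); Prop 4.2 (iv) p.315–316 (PDF pp.89–90); Lem 5.8 p.331 (PDF p.105); Prop 5.1
p.323 (PDF p.97); Cor 2.18 (i) p.285–286 (PDF pp.59–60)] -/
theorem thetaRootPreservedAll_ofThetaSettingYddFamily_final_v4_treeMonoidVocabWeak_of_cor218_i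
    (T : ThetaFrobenioidTower.{0} (BiKummerSetting.mkOfConnectedTemperoidYddTower (Cu.temperedArithmeticGroup e') tf hZ hP NH (Cu.thetaEnvTower τ hC
      hS) (ContinuousMulEquiv.refl _)).C (ConnectedPart (BTemp (Cu.temperedArithmeticGroup e').Pi)))
    (hT : T = ofThetaSettingFamily τ hC hS h Q R K' (fun N => (Units.map (tf.ratFnFunctor.map (t N).op).hom).comp c₀) (fun N =>
      tf.unitsMap_comp_injective (t N) hc₀ (ht N)) hinvc hinvp α β comm_sCap comm_sCup isIsometry_α degFr_α isIsometry_β degFr_β baseFrob_α)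
    {μ₁ : DS.CyclotomeMod l' (T.atLevel 1).N} {ι₁ : (T.atLevel 1).PiX ≃ₜ* (Cu.thetaEnvData μ₁ hC hS).PiX}
    {m₁ : (T.atLevel 1).muTorsion (T.atLevel 1).BN (T.atLevel 1).N ≃* (Cu.thetaEnvData μ₁ hC hS).mu}
    (act₁ : (T.atLevel 1).BiratAutAction) {Cst₁ : Subgroup ((T.atLevel 1).biratUnits (T.atLevel 1).BN)}
    {ν₁ : Cst₁ →* (PadicAlgCl p)ˣ}
    (hD₁ : ThetaFrobenioid.BiratAutAction.ConstantsDictionary act₁ Cu μ₁ hC hS ι₁ m₁ Cst₁ ν₁)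
    (hY₁ : (T.atLevel 1).IdentifiesPiY (Cu.thetaEnvData μ₁ hC hS) ι₁.toMulEquiv)
    {Dcnst : Type u₁} [Category.{v₁} Dcnst] (cnst : D₀ ⥤ Dcnst)
    (G : ConnectedPart (BTemp (Field.absoluteGaloisGroup DS.K)) ⥤ Dcnst)
    (ecn : tf.base ⋙ cnst ≅ QuasiTemperoid.pushforward (Cu.temperedArithmeticGroup e').aug.toMonoidHom (Cu.temperedArithmeticGroup
      e').aug_surjective (Cu.temperedArithmeticGroup e').augIsOpenMap_holds ⋙ G)
    (hP34 : RealifiedDivisorMonoids.Prop34Cnst T₀ cnst)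
    (hF : ∀ {B B' : (BiKummerSetting.mkOfConnectedTemperoidYddTower (Cu.temperedArithmeticGroup e') tf hZ hP NH (Cu.thetaEnvTower τ hC hS)
      (ContinuousMulEquiv.refl _)).C} (φ : B' ⟶ B) (y : (BiKummerSetting.mkOfConnectedTemperoidYddTower (Cu.temperedArithmeticGroup e') tf hZ hP NH
      (Cu.thetaEnvTower τ hC hS) (ContinuousMulEquiv.refl _)).biratUnits B), pullFrac φ y = tf.pullFracModel φ y)
    (hαover : ∀ N : ℕ+, α (one_dvd_level N) ≫ (R 1).α = (R N).α)
    (hcharAN : ∀ N : ℕ+, IsTopCharacteristic (Cu.temperedArithmeticGroup e').Pi (galoisSurjOf (Cu.temperedArithmeticGroup e').isTempered (R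
      N).AN.base.obj (R N).αData.isGalois).ker)
    (hdivA : ∀ αA : h44.Ψ.functor.obj (T.AN 1) ≅ T.AN 1, ∃ ε : Aut (T.AN 1), T.pre.div (αA.inv ≫ h44.Ψ.functor.map (T.sCap 1)) = T.pre.div (ε.hom ≫
      T.sCap 1) ∧ T.pre.div (αA.inv ≫ h44.Ψ.functor.map (T.sCup 1)) = T.pre.div (ε.hom ≫ T.sCup 1))
    {N' : ℕ+} (μ' : DS.CyclotomeMod l' N') (h15iii : DS.Prop15iii ES hC) (L : Cu.CuspLabels)
    (h218i : (Cu.rigidData μ' hC hS h15iii L).Cor218_i)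
    (hL : ∀ (A'' : (BiKummerSetting.mkOfConnectedTemperoidYddTower (Cu.temperedArithmeticGroup e') tf hZ hP NH (Cu.thetaEnvTower τ hC hS)
      (ContinuousMulEquiv.refl _)).C) (N : ℕ+) (g : A''.base ⟶ (R 1).AN.base) (ξ : tf.ratFnFunctor.obj (op (R 1).AN.base)),
      (BiKummerSetting.mkOfConnectedTemperoidYddTower (Cu.temperedArithmeticGroup e') tf hZ hP NH (Cu.thetaEnvTower τ hC hS)
      (ContinuousMulEquiv.refl _)).IsFrobeniusTrivial A'' → (BiKummerSetting.mkOfConnectedTemperoidYddTower (Cu.temperedArithmeticGroup e') tf hZ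
      hP NH (Cu.thetaEnvTower τ hC hS) (ContinuousMulEquiv.refl _)).IsNHSaturatedBsFld (BiKummerSetting.mkOfConnectedTemperoidYddTower
      (Cu.temperedArithmeticGroup e') tf hZ hP NH (Cu.thetaEnvTower τ hC hS) (ContinuousMulEquiv.refl _)).HodotBsFld A'' N →
      divB tf.divisorMonoid tf.ratFnFunctor tf.divBNatTrans (op (R 1).AN.base) ξ = 1 → ∃ ζ : tf.ratFnFunctor.obj (op A''.base), ζ ^ (N : ℕ) =
      pull tf.ratFnFunctor g ξ)
    (hcfix : ∀ (α₁ : h44.Ψ.functor.obj (R 1).AN ≅ (R 1).AN) (β₁ : h44.Ψ.functor.obj (R 1).BN ≅ (R 1).BN) (u₁ : Aut (R 1).BN) (_ : u₁ ∈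
      (BiKummerSetting.mkOfConnectedTemperoidYddTower (Cu.temperedArithmeticGroup e') tf hZ hP NH (Cu.thetaEnvTower τ hC hS)
      (ContinuousMulEquiv.refl _)).units (R 1).BN), α₁.inv ≫ h44.Ψ.functor.map (R 1).pair.num ≫ β₁.hom = (R 1).pair.num → α₁.inv ≫ h44.Ψ.functor.map
      (R 1).pair.den ≫ β₁.hom = (R 1).pair.den ≫ u₁.hom → ∀ (N : ℕ+), (BiKummerSetting.mkOfConnectedTemperoidYddTower (Cu.temperedArithmeticGroup
      e') tf hZ hP NH (Cu.thetaEnvTower τ hC hS) (ContinuousMulEquiv.refl _)).IsFixedByHA (R N).AN (R N).isSaturated.isAmple.isGalois (pullFrac (D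
      N).α₁ (pullFrac (R 1).pair.den (tf.isUnit_ratFnFunctor T₀.isUnit_BΛ (R 1).BN (ModelFrobenioid.unit u₁.hom)).unit)))
    (hc : ∀ (α₁ : h44.Ψ.functor.obj (T.AN 1) ≅ T.AN 1) (β₁ : h44.Ψ.functor.obj (T.BN 1) ≅ T.BN 1) (u₁ : Aut (T.BN 1)) (hu₁ : u₁ ∈ (T.atLevel
      1).units (T.BN 1)), α₁.inv ≫ h44.Ψ.functor.map (T.sCap 1) ≫ β₁.hom = T.sCap 1 → α₁.inv ≫ h44.Ψ.functor.map (T.sCup 1) ≫ β₁.hom = T.sCup 1 ≫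
      u₁.hom → ∀ c : T.Kˣ, (T.atLevel 1).unitsToBirat (T.BN 1) ⟨u₁, hu₁⟩ = T.constEmb 1 c → c ^ (2 * T.l) = 1) :
    T.ThetaRootPreservedAll h44.Ψ :=
  -- (`𝒯 := Cu.thetaEnvTower τ hC hS`, `ιX := id` are read off the type of `R`; passing `ContinuousMulEquiv.refl _` explicitly
  -- before `X` is determined makes the unifier normalise `Π^tp_X̲̲` and time out — cf. p448710)
  thetaRootPreservedAll_ofConnectedTemperoidYddFamily_final_v4 _ _ h Q Cu.odd_lPNat R K' hX₀ t c₀ hc₀ ht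
    hinvc hinvp α β comm_sCap comm_sCup isIsometry_α degFr_α isIsometry_β degFr_β baseFrob_α Cu hC hS h44 ψ hpull hii h3 h4b h8 h15a h15 D T hT
    (hnd_of_thm44Hyp_treeMonoidVocabWeak h44) act₁ hD₁
    hY₁ cnst G ecn hP34 (hYdd_thetaEnvTower_ofThetaSetting τ hC hS) hF hαover hcharAN hdivA
    (Cu.hP24_thetaEnvTower_of_cor218_i τ hC hS μ' h15iii L h218i) hL hcfix hc

end Weak

section Canonical

variable {p : ℕ} [Fact p.Prime] {DS : ThetaSetting p} {ES : DS.EtaleThetaData} {l' : ℕ} (Cu : ES.DoubleUnderline l')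
  {e' : DS.toTemperedCurve.GroupLevelData} {Es : Set ℕ+} (τ : DS.CyclotomeTower l' Es) (hC : DS.Compat) (hS : DS.Sec2Hyps)
  {D₀ : Type} [Category.{v₀} D₀] {T₀ : RealifiedDivisorMonoids (D₀ := D₀) treeMonoidVocab.{0}}
  {VD : FrdICatStub.{1, 0, 0} (ConnectedPart (BTemp (Cu.temperedArithmeticGroup e').Pi))}
  {tf : TemperedFrobenioid T₀ (ConnectedPart (BTemp (Cu.temperedArithmeticGroup e').Pi)) VD} {hZ : tf.monoidType = MonoidType.Z}
  {hP : ∀ A : (ConnectedPart (BTemp (Cu.temperedArithmeticGroup e').Pi))ᵒᵖ, IsPerfect (tf.Φ.carrier A)}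
  {NH : Subgroup (Field.absoluteGaloisGroup DS.K) → tf.category → ℕ+ → Prop}
  {pullFrac : ∀ {A A' : (BiKummerSetting.mkOfConnectedTemperoidYddTower (Cu.temperedArithmeticGroup e') tf hZ hP NH (Cu.thetaEnvTower τ hC hS)
    (ContinuousMulEquiv.refl _)).C} (_ : A' ⟶ A), (BiKummerSetting.mkOfConnectedTemperoidYddTower (Cu.temperedArithmeticGroup e') tf hZ hP NH
    (Cu.thetaEnvTower τ hC hS) (ContinuousMulEquiv.refl _)).biratUnits A → (BiKummerSetting.mkOfConnectedTemperoidYddTower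
    (Cu.temperedArithmeticGroup e') tf hZ hP NH (Cu.thetaEnvTower τ hC hS) (ContinuousMulEquiv.refl _)).biratUnits A'}
  {θ : (BiKummerSetting.mkOfConnectedTemperoidYddTower (Cu.temperedArithmeticGroup e') tf hZ hP NH (Cu.thetaEnvTower τ hC hS)
    (ContinuousMulEquiv.refl _)).biratUnits (BiKummerSetting.mkOfConnectedTemperoidYddTower (Cu.temperedArithmeticGroup e') tf hZ hP NH
    (Cu.thetaEnvTower τ hC hS) (ContinuousMulEquiv.refl _)).Aodot}
  {Bl : (BiKummerSetting.mkOfConnectedTemperoidYddTower (Cu.temperedArithmeticGroup e') tf hZ hP NH (Cu.thetaEnvTower τ hC hS)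
    (ContinuousMulEquiv.refl _)).C}
  {Pl : (BiKummerSetting.mkOfConnectedTemperoidYddTower (Cu.temperedArithmeticGroup e') tf hZ hP NH (Cu.thetaEnvTower τ hC hS)
    (ContinuousMulEquiv.refl _)).FractionPair θ Bl}
  {Rl : (BiKummerSetting.mkOfConnectedTemperoidYddTower (Cu.temperedArithmeticGroup e') tf hZ hP NH (Cu.thetaEnvTower τ hC hS)
    (ContinuousMulEquiv.refl _)).NthRoot θ Pl Cu.lPNat pullFrac}
  (h : ModelFrobenioid.Hypotheses tf.divisorMonoid tf.ratFnFunctor)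
  (Q : FrobenioidTheta.ThetaSubquotientStub.{0} (ConnectedPart (BTemp (Cu.temperedArithmeticGroup e').Pi)))
  (R : ∀ N : ℕ+, (BiKummerSetting.mkOfConnectedTemperoidYddTower (Cu.temperedArithmeticGroup e') tf hZ hP NH (Cu.thetaEnvTower τ hC hS)
    (ContinuousMulEquiv.refl _)).NthRoot Rl.root Rl.pair N pullFrac)
  (K' : Type) [Field K'] {X₀ : ConnectedPart (BTemp (Cu.temperedArithmeticGroup e').Pi)}
  (hX₀ : ∀ Y : ConnectedPart (BTemp (Cu.temperedArithmeticGroup e').Pi), Subsingleton (Y ⟶ X₀))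
  (t : ∀ N : ℕ+, (R N).BN.base ⟶ X₀) (c₀ : K'ˣ →* (tf.ratFnFunctor.obj (op X₀))ˣ)
  (hc₀ : Function.Injective c₀) (ht : ∀ N : ℕ+, Function.Injective (tf.ratFnFunctor.map (t N).op).hom)
  (hinvc : ∀ (N : ℕ+) (g : Aut (R N).AN.base), pull tf.divisorMonoid g.hom (ModelFrobenioid.div (R N).pair.num) = ModelFrobenioid.div (R
    N).pair.num)
  (hinvp : ∀ (N : ℕ+) (y : (Cu.thetaEnvTower τ hC hS).PiX), y ∈ (Cu.thetaEnvTower τ hC hS).PiYdd → pull tf.divisorMonoid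
    ((BiKummerSetting.mkOfConnectedTemperoidYddTower (Cu.temperedArithmeticGroup e') tf hZ hP NH (Cu.thetaEnvTower τ hC hS) (ContinuousMulEquiv.refl
    _)).galoisSurj (R N).AN.base (R N).αData.isGalois ((ContinuousMulEquiv.refl _) y)).hom (ModelFrobenioid.div (R N).pair.den) =
    ModelFrobenioid.div (R N).pair.den)
  (α : ∀ {N N' : ℕ+}, (N : ℕ) ∣ N' → ((R N').AN ⟶ (R N).AN))
  (β : ∀ {N N' : ℕ+}, (N : ℕ) ∣ N' → ((R N').BN ⟶ (R N).BN))
  (comm_sCap : ∀ {N N' : ℕ+} (hd : (N : ℕ) ∣ N'), (R N').pair.num ≫ β hd = α hd ≫ (R N).pair.num)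
  (comm_sCup : ∀ {N N' : ℕ+} (hd : (N : ℕ) ∣ N'), (R N').pair.den ≫ β hd = α hd ≫ (R N).pair.den)
  (isIsometry_α : ∀ {N N' : ℕ+} (hd : (N : ℕ) ∣ N'), ((BiKummerSetting.mkOfConnectedTemperoidYddTower (Cu.temperedArithmeticGroup e') tf hZ hP NH
    (Cu.thetaEnvTower τ hC hS) (ContinuousMulEquiv.refl _)).sec5Stub h).pre.IsIsometry (α hd))
  (degFr_α : ∀ {N N' : ℕ+} (hd : (N : ℕ) ∣ N'), (((BiKummerSetting.mkOfConnectedTemperoidYddTower (Cu.temperedArithmeticGroup e') tf hZ hP NH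
    (Cu.thetaEnvTower τ hC hS) (ContinuousMulEquiv.refl _)).sec5Stub h).pre.degFr (α hd) : ℕ) * N = N')
  (isIsometry_β : ∀ {N N' : ℕ+} (hd : (N : ℕ) ∣ N'), ((BiKummerSetting.mkOfConnectedTemperoidYddTower (Cu.temperedArithmeticGroup e') tf hZ hP NH
    (Cu.thetaEnvTower τ hC hS) (ContinuousMulEquiv.refl _)).sec5Stub h).pre.IsIsometry (β hd))
  (degFr_β : ∀ {N N' : ℕ+} (hd : (N : ℕ) ∣ N'), (((BiKummerSetting.mkOfConnectedTemperoidYddTower (Cu.temperedArithmeticGroup e') tf hZ hP NH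
    (Cu.thetaEnvTower τ hC hS) (ContinuousMulEquiv.refl _)).sec5Stub h).pre.degFr (β hd) : ℕ) * N = N')
  (baseFrob_α : ∀ {N N' : ℕ+} (hd : (N : ℕ) ∣ N'), (BiKummerSetting.mkOfConnectedTemperoidYddTower (Cu.temperedArithmeticGroup e') tf hZ hP NH
    (Cu.thetaEnvTower τ hC hS) (ContinuousMulEquiv.refl _)).IsOfBaseFrobeniusType (α hd))
  (h44 : BiKummerSetting.Thm44Hyp (BiKummerSetting.mkOfConnectedTemperoidYddTower (Cu.temperedArithmeticGroup e') tf hZ hP NH (Cu.thetaEnvTower τ hC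
    hS) (ContinuousMulEquiv.refl _)) (BiKummerSetting.mkOfConnectedTemperoidYddTower (Cu.temperedArithmeticGroup e') tf hZ hP NH (Cu.thetaEnvTower τ
    hC hS) (ContinuousMulEquiv.refl _)))
  (ψ : ∀ A : (BiKummerSetting.mkOfConnectedTemperoidYddTower (Cu.temperedArithmeticGroup e') tf hZ hP NH (Cu.thetaEnvTower τ hC hS)
    (ContinuousMulEquiv.refl _)).C, (BiKummerSetting.mkOfConnectedTemperoidYddTower (Cu.temperedArithmeticGroup e') tf hZ hP NH (Cu.thetaEnvTower τ
    hC hS) (ContinuousMulEquiv.refl _)).biratUnits A ≃* (BiKummerSetting.mkOfConnectedTemperoidYddTower (Cu.temperedArithmeticGroup e') tf hZ hP NH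
    (Cu.thetaEnvTower τ hC hS) (ContinuousMulEquiv.refl _)).biratUnits (h44.Ψ.functor.obj A))
  (hpull : ∀ {A A' : (BiKummerSetting.mkOfConnectedTemperoidYddTower (Cu.temperedArithmeticGroup e') tf hZ hP NH (Cu.thetaEnvTower τ hC hS)
    (ContinuousMulEquiv.refl _)).C} (φ : A' ⟶ A) (f : (BiKummerSetting.mkOfConnectedTemperoidYddTower (Cu.temperedArithmeticGroup e') tf hZ hP NH
    (Cu.thetaEnvTower τ hC hS) (ContinuousMulEquiv.refl _)).biratUnits A), ψ A' (pullFrac φ f) = pullFrac (h44.Ψ.functor.map φ) (ψ A f))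
  (hii : BiKummerSetting.Thm44_ii h44 ψ) (h3 : h44.PreservesFrobeniusStructure) (h4b : h44.PreservesBaseFrobeniusTypeData)
  (h8 : h44.PreservesAmple) (h15a : h44.PreservesFixedByHA ψ) (h15 : h44.PreservesSaturated ψ)
  (D : ∀ N : ℕ+, (BiKummerSetting.mkOfConnectedTemperoidYddTower (Cu.temperedArithmeticGroup e') tf hZ hP NH (Cu.thetaEnvTower τ hC hS)
    (ContinuousMulEquiv.refl _)).BaseFrobeniusTypeData (α (one_dvd_level N)))

include hX₀ h hc₀ ht comm_sCap comm_sCup isIsometry_α degFr_α isIsometry_β degFr_β hpull hii h3 h4b h8 h15a h15 in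
/-- **[EtTh] Theorem 5.7 — FINAL KNIT v4 at the tower OF THE SETTING, (A)-block EMPTY, canonical monoid vocabulary `treeMonoidVocab`**
(abc-iut-w5-d130: [FrdI] Def 1.1 (i) in full, finitely supported): abc-iut-f-123's `…_final_v4` at `(Π^tp_X̲̲, Cu.thetaEnvTower τ hC hS, id)` with
`hnd := hnd_of_thm44Hyp_treeMonoidVocab h44`, `hP24 := Cu.hP24_thetaEnvTower_of_cor218_i … h218i` (F-0620), `hYdd := hYdd_thetaEnvTower_ofThetaSetting …`.
RESIDUAL as in the weak variant — NO (A)-binder, NO `hP24`, NO `hsurj`, NO `hivPiso`.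
[cite: MochizukiEtTh2009, Thm 5.7 p.329–330 (PDF pp.103–104); Prop 4.2 (iv) p.315–316 (PDF pp.89–90); Lem 5.8 p.331 (PDF p.105); Prop 5.1
p.323 (PDF p.97); Cor 2.18 (i) p.285–286 (PDF pp.59–60)] -/
theorem thetaRootPreservedAll_ofThetaSettingYddFamily_final_v4_treeMonoidVocab_of_cor218_i
    (T : ThetaFrobenioidTower.{0} (BiKummerSetting.mkOfConnectedTemperoidYddTower (Cu.temperedArithmeticGroup e') tf hZ hP NH (Cu.thetaEnvTower τ hC
      hS) (ContinuousMulEquiv.refl _)).C (ConnectedPart (BTemp (Cu.temperedArithmeticGroup e').Pi)))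
    (hT : T = ofThetaSettingFamily τ hC hS h Q R K' (fun N => (Units.map (tf.ratFnFunctor.map (t N).op).hom).comp c₀) (fun N =>
      tf.unitsMap_comp_injective (t N) hc₀ (ht N)) hinvc hinvp α β comm_sCap comm_sCup isIsometry_α degFr_α isIsometry_β degFr_β baseFrob_α)
    {μ₁ : DS.CyclotomeMod l' (T.atLevel 1).N} {ι₁ : (T.atLevel 1).PiX ≃ₜ* (Cu.thetaEnvData μ₁ hC hS).PiX}
    {m₁ : (T.atLevel 1).muTorsion (T.atLevel 1).BN (T.atLevel 1).N ≃* (Cu.thetaEnvData μ₁ hC hS).mu}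
    (act₁ : (T.atLevel 1).BiratAutAction) {Cst₁ : Subgroup ((T.atLevel 1).biratUnits (T.atLevel 1).BN)}
    {ν₁ : Cst₁ →* (PadicAlgCl p)ˣ}
    (hD₁ : ThetaFrobenioid.BiratAutAction.ConstantsDictionary act₁ Cu μ₁ hC hS ι₁ m₁ Cst₁ ν₁)
    (hY₁ : (T.atLevel 1).IdentifiesPiY (Cu.thetaEnvData μ₁ hC hS) ι₁.toMulEquiv)
    {Dcnst : Type u₁} [Category.{v₁} Dcnst] (cnst : D₀ ⥤ Dcnst)
    (G : ConnectedPart (BTemp (Field.absoluteGaloisGroup DS.K)) ⥤ Dcnst)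
    (ecn : tf.base ⋙ cnst ≅ QuasiTemperoid.pushforward (Cu.temperedArithmeticGroup e').aug.toMonoidHom (Cu.temperedArithmeticGroup
      e').aug_surjective (Cu.temperedArithmeticGroup e').augIsOpenMap_holds ⋙ G)
    (hP34 : RealifiedDivisorMonoids.Prop34Cnst T₀ cnst)
    (hF : ∀ {B B' : (BiKummerSetting.mkOfConnectedTemperoidYddTower (Cu.temperedArithmeticGroup e') tf hZ hP NH (Cu.thetaEnvTower τ hC hS)
      (ContinuousMulEquiv.refl _)).C} (φ : B' ⟶ B) (y : (BiKummerSetting.mkOfConnectedTemperoidYddTower (Cu.temperedArithmeticGroup e') tf hZ hP NH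
      (Cu.thetaEnvTower τ hC hS) (ContinuousMulEquiv.refl _)).biratUnits B), pullFrac φ y = tf.pullFracModel φ y)
    (hαover : ∀ N : ℕ+, α (one_dvd_level N) ≫ (R 1).α = (R N).α)
    (hcharAN : ∀ N : ℕ+, IsTopCharacteristic (Cu.temperedArithmeticGroup e').Pi (galoisSurjOf (Cu.temperedArithmeticGroup e').isTempered (R
      N).AN.base.obj (R N).αData.isGalois).ker)
    (hdivA : ∀ αA : h44.Ψ.functor.obj (T.AN 1) ≅ T.AN 1, ∃ ε : Aut (T.AN 1), T.pre.div (αA.inv ≫ h44.Ψ.functor.map (T.sCap 1)) = T.pre.div (ε.hom ≫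
      T.sCap 1) ∧ T.pre.div (αA.inv ≫ h44.Ψ.functor.map (T.sCup 1)) = T.pre.div (ε.hom ≫ T.sCup 1))
    {N' : ℕ+} (μ' : DS.CyclotomeMod l' N') (h15iii : DS.Prop15iii ES hC) (L : Cu.CuspLabels)
    (h218i : (Cu.rigidData μ' hC hS h15iii L).Cor218_i)
    (hL : ∀ (A'' : (BiKummerSetting.mkOfConnectedTemperoidYddTower (Cu.temperedArithmeticGroup e') tf hZ hP NH (Cu.thetaEnvTower τ hC hS)
      (ContinuousMulEquiv.refl _)).C) (N : ℕ+) (g : A''.base ⟶ (R 1).AN.base) (ξ : tf.ratFnFunctor.obj (op (R 1).AN.base)),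
      (BiKummerSetting.mkOfConnectedTemperoidYddTower (Cu.temperedArithmeticGroup e') tf hZ hP NH (Cu.thetaEnvTower τ hC hS)
      (ContinuousMulEquiv.refl _)).IsFrobeniusTrivial A'' → (BiKummerSetting.mkOfConnectedTemperoidYddTower (Cu.temperedArithmeticGroup e') tf hZ
      hP NH (Cu.thetaEnvTower τ hC hS) (ContinuousMulEquiv.refl _)).IsNHSaturatedBsFld (BiKummerSetting.mkOfConnectedTemperoidYddTower
      (Cu.temperedArithmeticGroup e') tf hZ hP NH (Cu.thetaEnvTower τ hC hS) (ContinuousMulEquiv.refl _)).HodotBsFld A'' N →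
      divB tf.divisorMonoid tf.ratFnFunctor tf.divBNatTrans (op (R 1).AN.base) ξ = 1 → ∃ ζ : tf.ratFnFunctor.obj (op A''.base), ζ ^ (N : ℕ) =
      pull tf.ratFnFunctor g ξ)
    (hcfix : ∀ (α₁ : h44.Ψ.functor.obj (R 1).AN ≅ (R 1).AN) (β₁ : h44.Ψ.functor.obj (R 1).BN ≅ (R 1).BN) (u₁ : Aut (R 1).BN) (_ : u₁ ∈
      (BiKummerSetting.mkOfConnectedTemperoidYddTower (Cu.temperedArithmeticGroup e') tf hZ hP NH (Cu.thetaEnvTower τ hC hS)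
      (ContinuousMulEquiv.refl _)).units (R 1).BN), α₁.inv ≫ h44.Ψ.functor.map (R 1).pair.num ≫ β₁.hom = (R 1).pair.num → α₁.inv ≫ h44.Ψ.functor.map
      (R 1).pair.den ≫ β₁.hom = (R 1).pair.den ≫ u₁.hom → ∀ (N : ℕ+), (BiKummerSetting.mkOfConnectedTemperoidYddTower (Cu.temperedArithmeticGroup
      e') tf hZ hP NH (Cu.thetaEnvTower τ hC hS) (ContinuousMulEquiv.refl _)).IsFixedByHA (R N).AN (R N).isSaturated.isAmple.isGalois (pullFrac (D
      N).α₁ (pullFrac (R 1).pair.den (tf.isUnit_ratFnFunctor T₀.isUnit_BΛ (R 1).BN (ModelFrobenioid.unit u₁.hom)).unit)))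
    (hc : ∀ (α₁ : h44.Ψ.functor.obj (T.AN 1) ≅ T.AN 1) (β₁ : h44.Ψ.functor.obj (T.BN 1) ≅ T.BN 1) (u₁ : Aut (T.BN 1)) (hu₁ : u₁ ∈ (T.atLevel
      1).units (T.BN 1)), α₁.inv ≫ h44.Ψ.functor.map (T.sCap 1) ≫ β₁.hom = T.sCap 1 → α₁.inv ≫ h44.Ψ.functor.map (T.sCup 1) ≫ β₁.hom = T.sCup 1 ≫
      u₁.hom → ∀ c : T.Kˣ, (T.atLevel 1).unitsToBirat (T.BN 1) ⟨u₁, hu₁⟩ = T.constEmb 1 c → c ^ (2 * T.l) = 1) :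
    T.ThetaRootPreservedAll h44.Ψ :=
  -- (`𝒯 := Cu.thetaEnvTower τ hC hS`, `ιX := id` are read off the type of `R`; passing `ContinuousMulEquiv.refl _` explicitly
  -- before `X` is determined makes the unifier normalise `Π^tp_X̲̲` and time out — cf. p448710)
  thetaRootPreservedAll_ofConnectedTemperoidYddFamily_final_v4 _ _ h Q Cu.odd_lPNat R K' hX₀ t c₀ hc₀ ht
    hinvc hinvp α β comm_sCap comm_sCup isIsometry_α degFr_α isIsometry_β degFr_β baseFrob_α Cu hC hS h44 ψ hpull hii h3 h4b h8 h15a h15 D T hT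
    (hnd_of_thm44Hyp_treeMonoidVocab h44) act₁ hD₁
    hY₁ cnst G ecn hP34 (hYdd_thetaEnvTower_ofThetaSetting τ hC hS) hF hαover hcharAN hdivA
    (Cu.hP24_thetaEnvTower_of_cor218_i τ hC hS μ' h15iii L h218i) hL hcfix hc

end Canonical

end ThetaFrobenioidTower

end Literature.AnabelianGeometry.EtaleTheta

end
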